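import Literature.Combinatorics.SimpleGraph.HamiltonianGadgetSubstitution
import Mathlib.Logic.Relation
import HarnessLib

/-!
# Gadget substitution for Hamiltonian-path counts, IV: forcing arguments inside a gadget

Continuation of `HamiltonianGadgetSubstitution.lean`. To certify a gadget template — its
exclusivity `Exclusive` and its census `coverCount` — one analyses an arbitrary family of pairwise
disjoint port-to-port strands covering the gadget (`StrandFamily`: exactly the hypotheses of
`Exclusive`, and the shape of every cover, `strandFamily_coverFamily`) through its **link
relation** `Link T x y` ("`x` and `y` are consecutive on some strand"). This file proves the
generic facts such "forcing arguments" use (Garey–Johnson–Tarjan 1976, §2: "any Hamiltonian path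
must pass through each vertex of degree two ..."):

* links are gadget edges (`Link.adj`) and symmetric (`link_comm`);
* **every gadget vertex has exactly two links** (`StrandFamily.two_links`), with the convenient
  degree-two and degree-three forms `links_of_adj_two`, `link_iff_not_link_of_adj_three`;
* a port has at most one link (`StrandFamily.port_link_unique`) and only to a first or last inner
  vertex;
* every gadget vertex is joined through links inside the gadget to a vertex linked to a port
  (`StrandFamily.reach`), so **no link-closed set of gadget vertices exists** (`StrandFamily.not_closed`);
* **forced walks** (`StrandFamily.eq_of_forced`): if from the port `p₀` the links admit at every
  step only one continuation, the strand at `p₀` is that walk.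

## References

* M. R. Garey, D. S. Johnson, R. E. Tarjan, SIAM J. Comput. 5 (1976) 704–714, §2.
* M. R. Garey, D. S. Johnson, *Computers and Intractability*, Freeman 1979, §3.2.2.
-/

namespace Literature.Combinatorics.SimpleGraph

open scoped Classical

variable {α : Type*}

/-! ### Strand families and links -/

/-- The vertex list of a strand triple `(a, xs, b)`: `a, xs, b`. [folklore] -/
def piece (τ : α × List α × α) : List α :=
  τ.1 :: (τ.2.1 ++ [τ.2.2])

/-- **A strand family**: port-to-port strands of the gadget with pairwise distinct end ports and
pairwise disjoint interiors, together covering the gadget vertices `VX`; the ports `P` lie outside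
`VX`. (The hypotheses of `Exclusive`, with `P = ports S`.) [cite: GareyJohnson1979, §3.2.2] -/
structure StrandFamily (GX : _root_.SimpleGraph α) (VX P : Finset α) (T : Set (α × List α × α)) : Prop where
  /-- each member is a strand between ports -/
  strand : ∀ τ ∈ T, τ.1 ∈ P ∧ τ.2.2 ∈ P ∧ IsStrand GX VX τ.1 τ.2.2 τ.2.1
  /-- distinct members have distinct end ports and disjoint interiors -/
  distinct : ∀ τ ∈ T, ∀ τ' ∈ T, τ ≠ τ' →
    τ.1 ≠ τ'.1 ∧ τ.1 ≠ τ'.2.2 ∧ τ.2.2 ≠ τ'.1 ∧ τ.2.2 ≠ τ'.2.2 ∧ List.Disjoint τ.2.1 τ'.2.1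
  /-- the two end ports of a member differ -/
  ne : ∀ τ ∈ T, τ.1 ≠ τ.2.2
  /-- the interiors cover the gadget -/
  cover : ∀ x ∈ VX, ∃ τ ∈ T, x ∈ τ.2.1
  /-- ports are not gadget vertices -/
  port_not_mem : ∀ p ∈ P, p ∉ VX

/-- **Exclusivity from an analysis of strand families.** [folklore] -/
theorem exclusive_of_strandFamily [DecidableEq α] {GX : _root_.SimpleGraph α} {VX : Finset α} {S : Finset (α × α)}
    (hP : ∀ p ∈ ports S, p ∉ VX)
    (h : ∀ T, StrandFamily GX VX (ports S) T → ∀ τ ∈ T, slotOf S τ.1 τ.2.2) : Exclusive GX VX S :=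
  fun T h1 h2 h3 h4 => h T ⟨h1, h2, h3, h4, hP⟩

/-- The strand family of a cover: the strands `(e.1, f e, e.2)`, `e ∈ U`. [folklore] -/
def coverFamily (U : Finset (α × α)) (f : α × α → List α) : Set (α × List α × α) :=
  {τ | ∃ e ∈ U, τ = (e.1, f e, e.2)}

/-- Members of the cover family. [folklore] -/
theorem mem_coverFamily_iff {U : Finset (α × α)} {f : α × α → List α} {τ : α × List α × α} :
    τ ∈ coverFamily U f ↔ ∃ e ∈ U, τ = (e.1, f e, e.2) := Iff.rfl

/-- **The strands of a cover form a strand family** (for slots with pairwise distinct end points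
outside the gadget). [folklore] -/
theorem strandFamily_coverFamily [DecidableEq α] {GX : _root_.SimpleGraph α} {VX : Finset α} {U : Finset (α × α)}
    {f : α × α → List α} (hf : IsCover GX VX U f) (hU₁ : ∀ e ∈ U, e.1 ≠ e.2)
    (hU₂ : ∀ e ∈ U, ∀ e' ∈ U, e ≠ e' → e.1 ≠ e'.1 ∧ e.1 ≠ e'.2 ∧ e.2 ≠ e'.1 ∧ e.2 ≠ e'.2)
    (hP : ∀ p ∈ ports U, p ∉ VX) : StrandFamily GX VX (ports U) (coverFamily U f) := by
  refine ⟨?_, ?_, ?_, fun x hx => ?_, hP⟩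
  · rintro τ ⟨e, he, rfl⟩
    exact ⟨(mem_ports_of_mem he).1, (mem_ports_of_mem he).2, hf.1 e he⟩
  · rintro τ ⟨e, he, rfl⟩ τ' ⟨e', he', rfl⟩ hne
    have hee' : e ≠ e' := fun h => hne (by rw [h])
    obtain ⟨h1, h2, h3, h4⟩ := hU₂ e he e' he' hee'
    exact ⟨h1, h2, h3, h4, hf.2.2.1 e he e' he' hee'⟩
  · rintro τ ⟨e, he, rfl⟩
    exact hU₁ e he
  · obtain ⟨e, he, hxe⟩ := hf.2.2.2 x hx
    exact ⟨(e.1, f e, e.2), ⟨e, he, rfl⟩, hxe⟩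

/-- **The link relation of a strand family**: `x` and `y` are consecutive on some strand (ports
included). [cite: GareyJohnsonTarjan1976, §2] -/
def Link (T : Set (α × List α × α)) (x y : α) : Prop :=
  ∃ τ ∈ T, [x, y] <:+: piece τ ∨ [y, x] <:+: piece τ

/-- Links are symmetric. [folklore] -/
theorem link_comm {T : Set (α × List α × α)} {x y : α} : Link T x y ↔ Link T y x := by
  constructor <;> exact fun ⟨τ, hτ, h⟩ => ⟨τ, hτ, h.symm⟩

/-! ### Elementary list facts -/

/-- In a list with distinct entries written around an entry `x`, the entry after `x`. [folklore] -/
theorem eq_of_infix_of_decomp {l l₁ l₂ : List α} {p x s y : α} (hl : l.Nodup)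
    (hdec : l = l₁ ++ p :: x :: s :: l₂) (h : [x, y] <:+: l) : y = s := by
  obtain ⟨u, v, huv⟩ := h
  have h1 : l = u ++ x :: (y :: v) := by rw [← huv]; simp
  have h2 : l = (l₁ ++ [p]) ++ x :: (s :: l₂) := by rw [hdec]; simp
  have := (split_unique_of_nodup hl h1 h2).2
  exact (List.cons.inj this).1

/-- In a list with distinct entries written around an entry `x`, the entry before `x`. [folklore] -/
theorem eq_of_infix_of_decomp' {l l₁ l₂ : List α} {p x s y : α} (hl : l.Nodup)
    (hdec : l = l₁ ++ p :: x :: s :: l₂) (h : [y, x] <:+: l) : y = p := by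
  obtain ⟨u, v, huv⟩ := h
  have h1 : l = (u ++ [y]) ++ x :: v := by rw [← huv]; simp
  have h2 : l = (l₁ ++ [p]) ++ x :: (s :: l₂) := by rw [hdec]; simp
  have := (split_unique_of_nodup hl h1 h2).1
  exact List.append_inj_right' this rfl |> List.cons.inj |>.1

/-- An interior entry of a list sits between two entries. [folklore] -/
theorem exists_decomp_of_mem_interior {a b x : α} {xs : List α} (hx : x ∈ xs) :
    ∃ l₁ l₂ p s, a :: (xs ++ [b]) = l₁ ++ p :: x :: s :: l₂ := by
  obtain ⟨u, v, rfl⟩ := List.append_of_mem hx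
  rcases u.eq_nil_or_concat with rfl | ⟨u', p, rfl⟩
  · rcases v with _ | ⟨s, v⟩
    · exact ⟨[], [], a, b, by simp⟩
    · exact ⟨[], v ++ [b], a, s, by simp⟩
  · rcases v with _ | ⟨s, v⟩
    · exact ⟨a :: u', [], p, b, by simp⟩
    · exact ⟨a :: u', v ++ [b], p, s, by simp⟩

/-- Consecutive entries of a list are joined by the reflexive-transitive closure of "being
consecutive": from the head to any entry. [folklore] -/
theorem reflTransGen_head_of_mem {R : α → α → Prop} :
    ∀ {xs : List α} (_ : ∀ u v, [u, v] <:+: xs → R u v) {x : α} (_ : x ∈ xs) (hne : xs ≠ []),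
      Relation.ReflTransGen R (xs.head hne) x
  | [], _, _, hx, _ => absurd hx List.not_mem_nil
  | [y], _, x, hx, _ => by
    simp only [List.mem_singleton] at hx
    subst hx
    exact Relation.ReflTransGen.refl
  | y :: z :: zs, hR, x, hx, _ => by
    rcases List.mem_cons.1 hx with rfl | hx
    · exact Relation.ReflTransGen.refl
    · have hyz : R y z := hR y z ⟨[], zs, by simp⟩
      have ih := reflTransGen_head_of_mem (xs := z :: zs)
        (fun u v huv => hR u v (by obtain ⟨s, t, hst⟩ := huv; exact ⟨y :: s, t, by rw [← hst]; simp⟩)) hx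
        (List.cons_ne_nil _ _)
      exact Relation.ReflTransGen.head hyz ih

/-- Length of a piece. [folklore] -/
theorem length_piece (τ : α × List α × α) : (piece τ).length = τ.2.1.length + 2 := by
  simp [piece]

/-- Interior entries of a piece are inner vertices. [folklore] -/
theorem getElem_piece_mem {τ : α × List α × α} {i : ℕ} (hi : i < (piece τ).length) (h0 : 0 < i)
    (hi1 : i + 1 < (piece τ).length) : (piece τ)[i] ∈ τ.2.1 := by
  obtain ⟨j, rfl⟩ : ∃ j, i = j + 1 := ⟨i - 1, by omega⟩
  rw [length_piece] at hi1
  simp only [piece, List.getElem_cons_succ]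
  rw [List.getElem_append_left (by omega)]
  exact List.getElem_mem _

/-- The first entry of a piece. [folklore] -/
theorem getElem_piece_zero (τ : α × List α × α) (h : 0 < (piece τ).length) : (piece τ)[0] = τ.1 := by
  simp [piece]

/-- The entries of a piece after the first. [folklore] -/
theorem getElem_piece_succ {τ : α × List α × α} {i : ℕ} (hi : i < τ.2.1.length) (h : i + 1 < (piece τ).length) :
    (piece τ)[i + 1] = τ.2.1[i] := by
  simp only [piece, List.getElem_cons_succ]
  rw [List.getElem_append_left hi]

/-- The last entry of a piece. [folklore] -/
theorem getElem_piece_last (τ : α × List α × α) (h : τ.2.1.length + 1 < (piece τ).length) :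
    (piece τ)[τ.2.1.length + 1] = τ.2.2 := by
  simp only [piece, List.getElem_cons_succ]
  rw [List.getElem_append_right (le_refl _)]
  simp

namespace StrandFamily

variable {GX : _root_.SimpleGraph α} {VX P : Finset α} {T : Set (α × List α × α)}
  (hT : StrandFamily GX VX P T)
include hT

/-! ### Pieces -/

/-- The piece of a member has distinct entries. [folklore] -/
theorem piece_nodup {τ : α × List α × α} (hτ : τ ∈ T) : (piece τ).Nodup := by
  obtain ⟨h1, h2, -, hV, hnd, -⟩ := hT.strand τ hτ
  have ha : τ.1 ∉ τ.2.1 := fun h => hT.port_not_mem _ h1 (hV _ h)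
  have hb : τ.2.2 ∉ τ.2.1 := fun h => hT.port_not_mem _ h2 (hV _ h)
  have hab : τ.1 ≠ τ.2.2 := hT.ne τ hτ
  refine List.Nodup.cons ?_ (List.Nodup.append hnd (List.nodup_singleton _) ?_)
  · simp only [List.mem_append, List.mem_cons, List.not_mem_nil, or_false, not_or]
    exact ⟨ha, hab⟩
  · intro a ha' hmem
    simp only [List.mem_cons, List.not_mem_nil, or_false] at hmem
    exact hb (hmem ▸ ha')

/-- The piece of a member is a chain of gadget edges. [folklore] -/
theorem isChain_piece {τ : α × List α × α} (hτ : τ ∈ T) : List.IsChain GX.Adj (piece τ) :=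
  (hT.strand τ hτ).2.2.2.2.2

/-- A gadget vertex on a piece is an inner vertex of it. [folklore] -/
theorem mem_of_mem_piece {τ : α × List α × α} (hτ : τ ∈ T) {x : α} (hx : x ∈ piece τ) (hxV : x ∈ VX) :
    x ∈ τ.2.1 := by
  simp only [piece, List.mem_cons, List.mem_append, List.not_mem_nil, or_false] at hx
  rcases hx with rfl | hx | rfl
  · exact absurd hxV (hT.port_not_mem _ (hT.strand τ hτ).1)
  · exact hx
  · exact absurd hxV (hT.port_not_mem _ (hT.strand τ hτ).2.1)

/-- Two members sharing an inner vertex coincide. [folklore] -/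
theorem eq_of_mem_mem {τ τ' : α × List α × α} (hτ : τ ∈ T) (hτ' : τ' ∈ T) {x : α} (hx : x ∈ τ.2.1)
    (hx' : x ∈ τ'.2.1) : τ = τ' := by
  by_contra hne
  exact (hT.distinct τ hτ τ' hτ' hne).2.2.2.2 hx hx'

/-! ### Links -/

/-- **Links are gadget edges.** [folklore] -/
theorem adj_of_link {x y : α} (h : Link T x y) : GX.Adj x y := by
  obtain ⟨τ, hτ, h | h⟩ := h
  · have := (hT.isChain_piece hτ).infix h
    simpa using this
  · have := (hT.isChain_piece hτ).infix h
    simp only [List.isChain_cons_cons, List.isChain_singleton, and_true] at this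
    exact this.symm

/-- **The two links at a gadget vertex**, read off the piece through it. [folklore] -/
theorem link_iff_of_decomp {τ : α × List α × α} (hτ : τ ∈ T) {l₁ l₂ : List α} {p x s : α}
    (hdec : piece τ = l₁ ++ p :: x :: s :: l₂) (hxV : x ∈ VX) {y : α} : Link T x y ↔ y = p ∨ y = s := by
  have hnd := hT.piece_nodup hτ
  have hxτ : x ∈ τ.2.1 := hT.mem_of_mem_piece hτ (by rw [hdec]; simp) hxV
  constructor
  · rintro ⟨τ', hτ', h⟩
    have hx' : x ∈ piece τ' := by
      rcases h with h | h <;> exact h.subset (by simp)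
    have hττ' : τ = τ' := hT.eq_of_mem_mem hτ hτ' hxτ (hT.mem_of_mem_piece hτ' hx' hxV)
    subst hττ'
    rcases h with h | h
    · exact Or.inr (eq_of_infix_of_decomp hnd hdec h)
    · exact Or.inl (eq_of_infix_of_decomp' hnd hdec h)
  · rintro (rfl | rfl)
    · exact ⟨τ, hτ, Or.inr ⟨l₁, s :: l₂, by rw [hdec]; simp⟩⟩
    · exact ⟨τ, hτ, Or.inl ⟨l₁ ++ [p], l₂, by rw [hdec]; simp⟩⟩

/-- **Every gadget vertex has exactly two links**, to distinct vertices. [cite: GareyJohnsonTarjan1976, §2] -/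
theorem two_links {x : α} (hxV : x ∈ VX) :
    ∃ p s, p ≠ s ∧ Link T x p ∧ Link T x s ∧ ∀ y, Link T x y → y = p ∨ y = s := by
  obtain ⟨τ, hτ, hxτ⟩ := hT.cover x hxV
  obtain ⟨l₁, l₂, p, s, hdec⟩ := exists_decomp_of_mem_interior (a := τ.1) (b := τ.2.2) hxτ
  change piece τ = _ at hdec
  have hps : p ≠ s := by
    intro h
    subst h
    have hnd := hT.piece_nodup hτ
    rw [hdec] at hnd
    simp [List.nodup_append, List.nodup_cons] at hnd
  refine ⟨p, s, hps, ?_, ?_, fun y hy => (hT.link_iff_of_decomp hτ hdec hxV).1 hy⟩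
  · exact (hT.link_iff_of_decomp hτ hdec hxV).2 (Or.inl rfl)
  · exact (hT.link_iff_of_decomp hτ hdec hxV).2 (Or.inr rfl)

/-- A gadget vertex whose gadget neighbours are among `n₁, n₂` is linked to both, and to nothing
else ("a vertex of degree two forces both its edges"). [cite: GareyJohnsonTarjan1976, §2] -/
theorem links_of_adj_two {x n₁ n₂ : α} (hxV : x ∈ VX) (hN : ∀ y, GX.Adj x y → y = n₁ ∨ y = n₂) :
    Link T x n₁ ∧ Link T x n₂ ∧ ∀ y, Link T x y → y = n₁ ∨ y = n₂ := by
  obtain ⟨p, s, hps, hp, hs, honly⟩ := hT.two_links hxV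
  have hp' := hN p (hT.adj_of_link hp)
  have hs' := hN s (hT.adj_of_link hs)
  refine ⟨?_, ?_, fun y hy => hN y (hT.adj_of_link hy)⟩
  · rcases hp' with rfl | rfl
    · exact hp
    · rcases hs' with rfl | rfl
      · exact hs
      · exact absurd rfl hps
  · rcases hp' with rfl | rfl
    · rcases hs' with rfl | rfl
      · exact absurd rfl hps
      · exact hs
    · exact hp

/-- A gadget vertex whose gadget neighbours are among `n₁, n₂, n₃` and which is linked to `n₁` is
linked to exactly one of `n₂, n₃`. [cite: GareyJohnsonTarjan1976, §2] -/
theorem link_iff_not_link_of_adj_three {x n₁ n₂ n₃ : α} (hxV : x ∈ VX)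
    (hN : ∀ y, GX.Adj x y → y = n₁ ∨ y = n₂ ∨ y = n₃) (h₁₂ : n₁ ≠ n₂) (h₁₃ : n₁ ≠ n₃) (h₂₃ : n₂ ≠ n₃)
    (h₁ : Link T x n₁) : Link T x n₂ ↔ ¬ Link T x n₃ := by
  obtain ⟨p, s, hps, hp, hs, honly⟩ := hT.two_links hxV
  constructor
  · intro h₂ h₃
    -- three distinct links
    rcases honly _ h₁ with rfl | rfl <;> rcases honly _ h₂ with h | h <;> rcases honly _ h₃ with h' | h'
    all_goals first | exact h₁₂ h.symm | exact h₁₃ h'.symm | exact h₂₃ (h.trans h'.symm)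
  · intro h₃
    -- `p, s` are among `n₁, n₂, n₃`, distinct, not both avoiding `n₂` unless one is `n₃`
    have hp' := hN p (hT.adj_of_link hp)
    have hs' := hN s (hT.adj_of_link hs)
    rcases hp' with rfl | rfl | rfl
    · rcases hs' with rfl | rfl | rfl
      · exact absurd rfl hps
      · exact hs
      · exact absurd hs h₃
    · exact hp
    · exact absurd hp h₃

/-- **A port is linked only to the first or the last inner vertex of the member it ends.**
[folklore] -/
theorem link_port {p y : α} (hp : p ∉ VX) (h : Link T p y) :
    ∃ τ ∈ T, (τ.1 = p ∧ τ.2.1.head? = some y) ∨ (τ.2.2 = p ∧ τ.2.1.getLast? = some y) := by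
  obtain ⟨τ, hτ, h⟩ := h
  obtain ⟨-, -, hne, hV, -, -⟩ := hT.strand τ hτ
  refine ⟨τ, hτ, ?_⟩
  have hlen := length_piece τ
  obtain ⟨k, hk⟩ : ∃ k, τ.2.1.length = k + 1 := ⟨τ.2.1.length - 1, by
    have := List.length_pos_iff.2 hne; omega⟩
  -- `p` is not an interior entry of the piece
  have hint : ∀ i (hi : i < (piece τ).length), 0 < i → i + 1 < (piece τ).length → (piece τ)[i] ≠ p :=
    fun i hi h0 hi1 heq => hp (heq ▸ hV _ (getElem_piece_mem hi h0 hi1))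
  rcases h with h | h
  · obtain ⟨i, hi, hpi, hyi⟩ := pair_infix_iff.1 h
    have hi0 : i = 0 := by
      by_contra hi0
      exact hint i (by omega) (by omega) hi hpi
    subst hi0
    left
    rw [getElem_piece_zero τ (by omega)] at hpi
    refine ⟨hpi, ?_⟩
    have h1 : (piece τ)[0 + 1] = τ.2.1[0] := getElem_piece_succ (by omega) hi
    rw [hyi] at h1
    rw [h1, List.head?_eq_getElem?, List.getElem?_eq_getElem (by omega)]
  · obtain ⟨i, hi, hyi, hpi⟩ := pair_infix_iff.1 h
    have hi1 : i = k + 1 := by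
      by_contra hne'
      exact hint (i + 1) hi (by omega) (by omega) hpi
    subst hi1
    right
    have hlast : (piece τ)[τ.2.1.length + 1]'(by omega) = τ.2.2 := getElem_piece_last τ (by omega)
    have hlast' : (piece τ)[k + 1 + 1] = (piece τ)[τ.2.1.length + 1]'(by omega) := by congr 1; omega
    refine ⟨by rw [← hlast, ← hlast', hpi], ?_⟩
    have h1 : (piece τ)[k + 1] = τ.2.1[k] := getElem_piece_succ (by omega) (by omega)
    rw [hyi] at h1
    rw [h1, List.getLast?_eq_getElem?, List.getElem?_eq_getElem (by omega)]
    congr 1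
    simp [hk]

/-- **A port has at most one link.** [folklore] -/
theorem port_link_unique {p y₁ y₂ : α} (hp : p ∉ VX) (h₁ : Link T p y₁) (h₂ : Link T p y₂) : y₁ = y₂ := by
  obtain ⟨τ, hτ, hc⟩ := hT.link_port hp h₁
  obtain ⟨τ', hτ', hc'⟩ := hT.link_port hp h₂
  by_cases hne : τ = τ'
  · subst hne
    rcases hc with ⟨ha, hy⟩ | ⟨hb, hy⟩ <;> rcases hc' with ⟨ha', hy'⟩ | ⟨hb', hy'⟩
    · exact Option.some_injective _ (hy.symm.trans hy')
    · exact absurd (ha.trans hb'.symm) (hT.ne τ hτ)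
    · exact absurd (ha'.trans hb.symm) (hT.ne τ hτ)
    · exact Option.some_injective _ (hy.symm.trans hy')
  · obtain ⟨d1, d2, d3, d4, -⟩ := hT.distinct τ hτ τ' hτ' hne
    rcases hc with ⟨ha, -⟩ | ⟨hb, -⟩ <;> rcases hc' with ⟨ha', -⟩ | ⟨hb', -⟩
    · exact absurd (ha.trans ha'.symm) d1
    · exact absurd (ha.trans hb'.symm) d2
    · exact absurd (hb.trans ha'.symm) d3
    · exact absurd (hb.trans hb'.symm) d4

/-- A linked port is an end port of some member. [folklore] -/
theorem exists_end_of_link_port {p y : α} (hp : p ∉ VX) (h : Link T p y) : ∃ τ ∈ T, τ.1 = p ∨ τ.2.2 = p := by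
  obtain ⟨τ, hτ, hc⟩ := hT.link_port hp h
  exact ⟨τ, hτ, hc.imp (fun h => h.1) (fun h => h.1)⟩

/-! ### Reachability: no closed set of gadget vertices -/

/-- **Every gadget vertex is joined, through links between gadget vertices, to a gadget vertex
linked to a port** (namely the first inner vertex of its strand). [folklore] -/
theorem reach {x : α} (hxV : x ∈ VX) :
    ∃ p ∈ P, ∃ h, Link T p h ∧ Relation.ReflTransGen (fun u v => Link T u v ∧ u ∈ VX ∧ v ∈ VX) h x := by
  obtain ⟨τ, hτ, hxτ⟩ := hT.cover x hxV
  obtain ⟨h1, -, hne, hV, -, -⟩ := hT.strand τ hτ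
  obtain ⟨x₁, rest, hxs⟩ := List.exists_cons_of_ne_nil hne
  refine ⟨τ.1, h1, x₁, ⟨τ, hτ, Or.inl ⟨[], rest ++ [τ.2.2], by simp [piece, hxs]⟩⟩, ?_⟩
  have key := reflTransGen_head_of_mem (R := fun u v => Link T u v ∧ u ∈ VX ∧ v ∈ VX) (xs := τ.2.1)
    (fun u v huv => ⟨⟨τ, hτ, Or.inl ?_⟩, hV u (huv.subset (by simp)), hV v (huv.subset (by simp))⟩) hxτ hne
  · rw [show τ.2.1.head hne = x₁ from by simp [hxs]] at key
    exact key
  · obtain ⟨s, t, hst⟩ := huv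
    exact ⟨τ.1 :: s, t ++ [τ.2.2], by rw [piece, ← hst]; simp⟩

/-- **No link-closed set of gadget vertices**: a set of gadget vertices containing, with each of
its elements, everything linked to it, is empty. [folklore] -/
theorem not_closed {C : Set α} (hC : ∀ u ∈ C, ∀ v, Link T u v → v ∈ C) (hCV : ∀ u ∈ C, u ∈ VX) {x : α}
    (hx : x ∈ C) : False := by
  obtain ⟨p, hp, h, hph, hreach⟩ := hT.reach (hCV x hx)
  -- walk back from `x` to `h` inside `C` (links are symmetric, `C` is closed)
  have hback : ∀ {v}, Relation.ReflTransGen (fun u v => Link T u v ∧ u ∈ VX ∧ v ∈ VX) h v → v ∈ C → h ∈ C := by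
    intro v hv
    induction hv with
    | refl => exact id
    | tail _ huv ih => exact fun hc => ih (hC _ hc _ (link_comm.1 huv.1))
  have hhC : h ∈ C := hback hreach hx
  have hpC : p ∈ C := hC h hhC p (link_comm.1 hph)
  exact hT.port_not_mem p hp (hCV p hpC)

/-! ### Forced walks -/

omit hT in
/-- The core of the forced-walk argument, for an abstract list `Q` starting at `p₀` whose
consecutive entries are linked, whose interior entries are gadget vertices and whose last entry
is not. [folklore] -/
theorem eq_of_forced_aux {W Q : List α} {p₀ : α} (hW0 : W.head? = some p₀) (hQ0 : Q.head? = some p₀)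
    (hW3 : 3 ≤ W.length) (hQ3 : 3 ≤ Q.length) (hQnd : Q.Nodup)
    (hWV : ∀ i (hi : i < W.length), 0 < i → i + 1 < W.length → W[i] ∈ VX)
    (hWlast : ∀ (h : W.length - 1 < W.length), W[W.length - 1] ∉ VX)
    (hQV : ∀ i (hi : i < Q.length), 0 < i → i + 1 < Q.length → Q[i] ∈ VX)
    (hQlast : ∀ (h : Q.length - 1 < Q.length), Q[Q.length - 1] ∉ VX)
    (hQlink : ∀ i (hi : i + 1 < Q.length), Link T Q[i] Q[i + 1])
    (hfirst : ∀ y, Link T p₀ y → ∀ (h : 1 < W.length), y = W[1])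
    (hstep : ∀ i (hi : i + 2 < W.length) y, Link T W[i + 1] y → y = W[i] ∨ y = W[i + 2]) : Q = W := by
  -- pointwise agreement on the common range
  have hagree : ∀ i (hQ : i < Q.length) (hWi : i < W.length), Q[i] = W[i] := by
    intro i
    induction i using Nat.strong_induction_on with
    | _ i ih =>
      intro hQ hWi
      match i, ih with
      | 0, _ =>
        have h1 := List.head?_eq_getElem?.symm.trans hQ0
        have h2 := List.head?_eq_getElem?.symm.trans hW0
        rw [List.getElem?_eq_some_iff] at h1 h2
        obtain ⟨_, h1⟩ := h1
        obtain ⟨_, h2⟩ := h2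
        rw [h1, h2]
      | 1, ih =>
        have h0 : Q[0] = p₀ := by
          have h1 := List.head?_eq_getElem?.symm.trans hQ0
          rw [List.getElem?_eq_some_iff] at h1
          exact h1.2
        have hl := hQlink 0 hQ
        rw [h0] at hl
        exact hfirst _ hl hWi
      | i + 2, ih =>
        have hl := hQlink (i + 1) hQ
        rw [ih (i + 1) (by omega) (by omega) (by omega)] at hl
        rcases hstep i hWi _ hl with h | h
        · -- would repeat the entry two steps back
          exfalso
          have hback : Q[i + 2] = Q[i] := by rw [h, ih i (by omega) (by omega) (by omega)]
          have := (hQnd.getElem_inj_iff).1 hback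
          omega
        · exact h
  -- equal lengths
  have hlen : Q.length = W.length := by
    by_contra hne
    rcases Nat.lt_or_gt_of_ne hne with hlt | hgt
    · -- `Q` ends inside `W`'s interior
      have hm := hagree (Q.length - 1) (by omega) (by omega)
      have hin : W[Q.length - 1] ∈ VX := hWV _ (by omega) (by omega) (by omega)
      rw [← hm] at hin
      exact hQlast (by omega) hin
    · have hm := hagree (W.length - 1) (by omega) (by omega)
      have hin : Q[W.length - 1] ∈ VX := hQV _ (by omega) (by omega) (by omega)
      rw [hm] at hin
      exact hWlast (by omega) hin
  exact List.ext_getElem hlen fun i h₁ h₂ => hagree i h₁ h₂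

/-- **Forced walks.** Let `W = p₀, w₁, …, w_k, p₁` (`k ≥ 1`) with the `wᵢ` gadget vertices and
`p₁` not, such that the only vertex linked to `p₀` can be `w₁` and, for each interior entry of
`W`, the vertices linked to it are among its two neighbours on `W`. Then the member of the family
ending at `p₀` is `W` (read in the appropriate direction). [cite: GareyJohnsonTarjan1976, §2] -/
theorem eq_of_forced {p₀ p₁ : α} {ws : List α} (hws : ws ≠ []) (hwsV : ∀ w ∈ ws, w ∈ VX) (hp₁ : p₁ ∉ VX)
    (hfirst : ∀ y, Link T p₀ y → some y = ws.head?)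
    (hstep : ∀ i (hi : i + 2 < (p₀ :: (ws ++ [p₁])).length) y,
      Link T (p₀ :: (ws ++ [p₁]))[i + 1] y → y = (p₀ :: (ws ++ [p₁]))[i] ∨ y = (p₀ :: (ws ++ [p₁]))[i + 2])
    {τ : α × List α × α} (hτ : τ ∈ T) :
    (τ.1 = p₀ → τ = (p₀, ws, p₁)) ∧ (τ.2.2 = p₀ → τ = (p₁, ws.reverse, p₀)) := by
  set W := p₀ :: (ws ++ [p₁]) with hWdef
  obtain ⟨h1, h2, hne, hV, hnd, -⟩ := hT.strand τ hτ
  have hpnd := hT.piece_nodup hτ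
  obtain ⟨w₁, ws', hws₁⟩ := List.exists_cons_of_ne_nil hws
  -- data about `W`
  have hW0 : W.head? = some p₀ := rfl
  have hW3 : 3 ≤ W.length := by
    simp only [hWdef, List.length_cons, List.length_append, List.length_nil, hws₁]; omega
  have hWV : ∀ i (hi : i < W.length), 0 < i → i + 1 < W.length → W[i] ∈ VX := by
    intro i hi h0 hi1
    obtain ⟨j, rfl⟩ : ∃ j, i = j + 1 := ⟨i - 1, by omega⟩
    simp only [hWdef, List.length_cons, List.length_append, List.length_nil] at hi1
    simp only [hWdef, List.getElem_cons_succ]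
    rw [List.getElem_append_left (by omega)]
    exact hwsV _ (List.getElem_mem _)
  have hWlast : ∀ (h : W.length - 1 < W.length), W[W.length - 1] ∉ VX := by
    intro h
    have : W[W.length - 1] = p₁ := by
      rw [← List.getLast_eq_getElem (by simp [hWdef])]
      simp [hWdef]
    rw [this]; exact hp₁
  have hfirst' : ∀ y, Link T p₀ y → ∀ (h : 1 < W.length), y = W[1] := by
    intro y hy h
    have := hfirst y hy
    rw [hws₁] at this
    simp only [List.head?_cons, Option.some.injEq] at this
    simp [hWdef, hws₁, this]
  constructor
  · intro hτ1
    -- `Q = piece τ`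
    have key := eq_of_forced_aux (Q := piece τ) hW0 (by simp [piece, hτ1]) hW3
      (by obtain ⟨x, r, hx⟩ := List.exists_cons_of_ne_nil hne; simp [piece, hx]) hpnd hWV hWlast
      ?_ ?_ ?_ hfirst' hstep
    · have : τ.2.1 ++ [τ.2.2] = ws ++ [p₁] := List.cons.inj key |>.2
      obtain ⟨hxs, hb⟩ := List.append_inj' this rfl
      simp only [List.cons.injEq, and_true] at hb
      obtain ⟨a, xs, b⟩ := τ
      simp only at hτ1 hxs hb
      rw [hτ1, hxs, hb]
    · exact fun i hi h0 hi1 => hV _ (getElem_piece_mem hi h0 hi1)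
    · intro h
      have : (piece τ)[(piece τ).length - 1] = τ.2.2 := by
        rw [← List.getLast_eq_getElem (by simp [piece])]
        simp [piece]
      rw [this]
      exact hT.port_not_mem _ h2
    · exact fun i hi => ⟨τ, hτ, Or.inl (pair_infix_iff.2 ⟨i, hi, rfl, rfl⟩)⟩
  · intro hτ2
    -- `Q = (piece τ).reverse`
    have hrev : (piece τ).reverse = τ.2.2 :: (τ.2.1.reverse ++ [τ.1]) := by simp [piece]
    have key := eq_of_forced_aux (Q := (piece τ).reverse) hW0 (by simp [hrev, hτ2]) hW3
      (by obtain ⟨x, r, hx⟩ := List.exists_cons_of_ne_nil hne; simp [piece, hx])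
      (List.nodup_reverse.2 hpnd) hWV hWlast ?_ ?_ ?_ hfirst' hstep
    · rw [hrev] at key
      have : τ.2.1.reverse ++ [τ.1] = ws ++ [p₁] := List.cons.inj key |>.2
      obtain ⟨hxs, hb⟩ := List.append_inj' this rfl
      simp only [List.cons.injEq, and_true] at hb
      obtain ⟨a, xs, b⟩ := τ
      simp only at hτ2 hxs hb
      rw [hτ2, hb, ← hxs, List.reverse_reverse]
    · intro i hi h0 hi1
      rw [List.getElem_reverse]
      have hl : (piece τ).reverse.length = (piece τ).length := List.length_reverse
      exact hV _ (getElem_piece_mem (by omega) (by omega) (by omega))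
    · intro h
      have : (piece τ).reverse[(piece τ).reverse.length - 1] = τ.1 := by
        rw [← List.getLast_eq_getElem (by simp [piece])]
        simp [hrev]
      rw [this]
      exact hT.port_not_mem _ h1
    · intro i hi
      have hl : (piece τ).reverse.length = (piece τ).length := List.length_reverse
      refine ⟨τ, hτ, Or.inr (pair_infix_iff.2 ⟨(piece τ).length - 2 - i, by omega, ?_, ?_⟩)⟩
      · simp only [List.getElem_reverse]
        congr 1
        omega
      · simp only [List.getElem_reverse]
        congr 1
        omega

/-- All members of the family coincide with a member whose inner vertices exhaust the gadget.
[folklore] -/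
theorem eq_of_forall_mem {τ₀ : α × List α × α} (hτ₀ : τ₀ ∈ T) (hall : ∀ x ∈ VX, x ∈ τ₀.2.1) {τ : α × List α × α}
    (hτ : τ ∈ T) : τ = τ₀ := by
  obtain ⟨-, -, hne, hV, -, -⟩ := hT.strand τ hτ
  obtain ⟨x, hx⟩ := List.exists_mem_of_ne_nil τ.2.1 hne
  exact hT.eq_of_mem_mem hτ hτ₀ hx (hall x (hV x hx))

end StrandFamily

end Literature.Combinatorics.SimpleGraph
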